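import Summits.NavierStokesRegularity.FunctionalMining.NoGo.TopEigFrameSpread
import Summits.NavierStokesRegularity.FunctionalMining.StrainEigContinuous
import HarnessLib

/-!
# FunctionalMining / NoGo — K65: INVERSE-GAP TURNING FLOOR on everywhere-simple fields of `T³`
# `Φ₁(v)² ≤ 3‖v‖_∞² · heatDissipation Φ_q v · ∫ dx/(qλ₁^{q−1}(λ₁ − λ₂))`, every real `q ≥ 1`

HONEST FRAMING. Search for candidate a priori estimates; no regularity claim. Nothing about
Navier–Stokes is proved or asserted in this file. Cell `pub-nsfunc`, no-go seat (gen 54). Door (e) box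
of `NOGO.md` (STRUCTURE ONLY): a constraint on the SHAPE of a killing family for the open node
Lemma L-λ(q) = `TopEigHeatCoercivePos q` (door (b)/(F2) wants `¬ TopEigHeatCoercivePos q`: smooth
divergence-free `v_n` on `T³` with `heatDissipation Φ_q v_n ≤ c_n Φ_q(v_n)`, `c_n → 0`;
`Φ_q = torusTopEigMoment q = ∫ (λ₁⁺)^q`, `λ₁ ≥ λ₂ ≥ λ₃` the strain eigenvalues).
SETTING. `v` smooth, divergence free on `T³`, top strain eigenvalue SIMPLE AT EVERY POINT (`λ₂ < λ₁`
everywhere; then `λ₁ > 0`, `λ₁ ∈ C^∞`, tree `TopEigChannelIntegralSimple`); `P₁ = topProj v = u₀ ⊗ u₀`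
the tree's sign-free top projector field (`TopEigProjectorDeriv`; `C^∞` here, `isSmooth_topProj_entry`);
`|∇P₁|² = Σₖᵢⱼ (∂ₖ(P₁)ᵢⱼ)²` (twice the squared turning rate of the top eigen-line);
`w_q = qλ₁^{q−1}(λ₁ − λ₂) > 0` the GAP WEIGHT (continuous, so `∫ w_q⁻¹` is a genuine finite integral).
CONTENT. § 1 **`gap_mul_sum_sq_partialDeriv_topProj_le`** (pointwise at a simple point):
`(λ₁ − λ₂)|∇P₁|² ≤ Δλ₁ − μ(S; S(Δv))` [right side = the frame density `fd` of K63
`NoGo/TopEigHeatFrameDensity`]: the tree's R-form `Δλ₁ − μ = 2Σₖ Σ_{a≠a₀} (u_aᵀS(∂ₖv)u₀)²/(λ₁ − κ_a)`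
(`laplacian_torusStrainTopEig_eq_sum_frame`) against `|∂ₖP₁|² = 2Σ_{a≠a₀} (u_aᵀS(∂ₖv)u₀)²/(λ₁ − κ_a)²`
(`sum_sq_partialDeriv_topProj_eq`) and `κ_a ≤ λ₂`. § 2 **`integral_topEig_eq_neg_integral_transport`**
(TRANSPORT IDENTITY): `∫ λ₁ = ∫ S : P₁ = −∫ Σⱼ vⱼ Σᵢ ∂ᵢ(P₁)ᵢⱼ` (`S u₀ = λ₁u₀`; integration by parts).
§ 3 **`topEigMoment_one_le_of_simple`** (`L∞–L¹` PAIRING): `‖v‖ ≤ M` ⇒ `Φ₁(v) ≤ M√3 ∫ |∇P₁|`.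
§ 4 **`integral_weight_mul_le_heatDissipation`** (`q ≥ 1`): `∫ w_q|∇P₁|² ≤ heatDissipation Φ_q v` —
§ 1 inside the tree's exact channel formula `heat = ∫ [q(q−1)λ₁^{q−2}|∇λ₁|² + qλ₁^{q−1}(Δλ₁ − μ)]`
(`heatDissipation_topEigMoment_eq_integral_of_simple`, F1 PART I Cor. 3′ (a)).
§ 5 **`sq_integral_sqrt_le`** (Cauchy–Schwarz) `(∫ |∇P₁|)² ≤ (∫ w_q|∇P₁|²) ∫ w_q⁻¹`; ASSEMBLY
**`topEigMoment_one_sq_le`**: `Φ₁(v)² ≤ 3M² · heatDissipation Φ_q v · ∫ w_q⁻¹`; KILL-RULE FORM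
**`topEigMoment_one_sq_le_of_heat_le`**: `heat ≤ cΦ_q(v)` ⇒ `Φ₁(v)² ≤ 3M² · cΦ_q(v) · ∫ w_q⁻¹`
(both sides scale alike under `v ↦ μv` and `x ↦ Nx`).
MEANING FOR (F2) (design rule (R14), records only). INVERSE-GAP BLOW-UP: along an everywhere-simple
killing family `∫_{T³} dx/(qλ₁^{q−1}(λ₁ − λ₂)) ≥ Φ₁(v_n)²/(3‖v_n‖_∞² c_n Φ_q(v_n)) → ∞` whenever the
scale-free shape factor `Φ₁²/(‖v‖_∞² Φ_q)` stays bounded below: the near-crossing set `{λ₂ ≈ λ₁}` must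
be FAT IN HARMONIC MEAN — slow turning of the top line with a healthy gap cannot kill, at ANY real
`q ≥ 1`. Complements the tree's uniform-gap coercivity at `q = 2` (`TopEigGapCoerciveSimple`: `λ₂ ≤
(1−η)λ₁` everywhere ⇒ `(2π²η²/27)Φ₂ ≤ heat`, an `inf`-gap statement via Poincaré): an INTEGRATED gap
condition over the whole range of the node, paid for by the `L∞–L¹` pairing instead of Poincaré; it
quantifies (R13′) of K54 (`NoGo/TopEigFrameSpread`: the top frame must turn through an `O(1)` angle).
NOT CLAIMED: anything for fields WITH eigenvalue crossings (the seamed designs of door (e) are not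
everywhere simple: across a seam `P₁` jumps and § 2 acquires seam terms — pen remark, not kernelised),
any sign of `heatDissipation` in general, any verdict on L-λ(q): OPEN in the kernel for every real
`q > 1`; (F2) WANTED/OPEN; no node decided. [ours = §§ 1–5 as stated; folklore = integration by parts
on `T³`, Cauchy–Schwarz, first-order perturbation of a simple eigenvalue (Kato II-§5) — via the tree]
FILING (prove seat g30, REQUEST #94): declarations byte-identical to the no-go seat's staged `TopEigHeatInverseGap.STAGING.lean` dc38dcabb454262f; this line is the only addition.
-/

noncomputable section

open Filter Topology Matrix Finset MeasureTheory
open scoped ContDiff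

namespace Summit.NavierStokesRegularity.FunctionalMining

open Literature.Analysis Literature.Analysis.FunctionSpaces Literature.Analysis.FunctionSpaces.Torus
  SharpClass.DirectorForm Literature.Analysis.Matrix

namespace TopEig.InverseGap

variable {v : UnitAddTorus (Fin 3) → EuclideanSpace ℝ (Fin 3)} {q : ℝ}

/-- Gap form at every point, in the `∃`-shape the tree's simple-case theorems take. [tree, bookkeeping] -/
private theorem gapForm_of_simple
    (hsimple : ∀ x : UnitAddTorus (Fin 3), torusStrainMidEig v x < torusStrainTopEig v x)
    (x : UnitAddTorus (Fin 3)) :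
    ∃ (e : Fin 3 → ℝ) (lam g : ℝ), e ⬝ᵥ e = 1 ∧ torusStrainMatrix v x *ᵥ e = lam • e ∧ 0 < g ∧
      ∀ w, w ⬝ᵥ e = 0 → w ⬝ᵥ torusStrainMatrix v x *ᵥ w ≤ (lam - g) * (w ⬝ᵥ w) :=
  let ⟨e, he1, hSe, hg, hgap⟩ := exists_gapForm_of_midEig_lt_topEig (hsimple x)
  ⟨e, _, _, he1, hSe, hg, hgap⟩

/-- `λ₁ > 0` at every point of an everywhere-simple divergence-free field (tree `lam_pos_of_gapForm_of_isDivFree`). [tree] -/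
private theorem topEig_pos_everywhere (hv : Torus.IsSmooth v) (hdiv : Torus.IsDivFree v)
    (hsimple : ∀ x : UnitAddTorus (Fin 3), torusStrainMidEig v x < torusStrainTopEig v x)
    (x : UnitAddTorus (Fin 3)) : 0 < torusStrainTopEig v x := by
  obtain ⟨e, he1, hSe, hg, hgap⟩ := exists_gapForm_of_midEig_lt_topEig (hsimple x)
  exact (lam_pos_of_gapForm_of_isDivFree hv hdiv he1 hSe hg hgap).2

/-- `∂ᵢ(vⱼ) = (∂ᵢ v)ⱼ`. [folklore] -/
private theorem partialDeriv_coord' (hv : Torus.IsSmooth v) (i j : Fin 3) (x : UnitAddTorus (Fin 3)) :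
    Torus.partialDeriv i (fun y => v y j) x = Torus.partialDeriv i v x j :=
  Torus.partialDeriv_clm_comp hv (EuclideanSpace.proj j : EuclideanSpace ℝ (Fin 3) →L[ℝ] ℝ) i x

/-- Integration by parts on `T³` for smooth scalars: `∫ (∂ᵢa) b = −∫ a ∂ᵢb`. [folklore] -/
private theorem integral_partialDeriv_mul_eq_neg' {a b : UnitAddTorus (Fin 3) → ℝ}
    (ha : Torus.IsSmooth a) (hb : Torus.IsSmooth b) (i : Fin 3) :
    ∫ x, Torus.partialDeriv i a x * b x = -∫ x, a x * Torus.partialDeriv i b x := by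
  have h0 := integral_partialDeriv_eq_zero_holds (ha.smul' hb) i
  simp_rw [partialDeriv_smul (ha.isContDiff (by simp)) (hb.isContDiff (by simp)), smul_eq_mul] at h0
  have h1 : Integrable fun x => a x * Torus.partialDeriv i b x :=
    (ha.continuous.mul (hb.partialDeriv i).continuous).integrable_unitAddTorus
  have h2 : Integrable fun x => Torus.partialDeriv i a x * b x :=
    ((ha.partialDeriv i).continuous.mul hb.continuous).integrable_unitAddTorus
  rw [integral_add h1 h2] at h0
  linarith

/-- **§ 1 `(λ₁ − λ₂)(x) · Σₖᵢⱼ (∂ₖ(P₁)ᵢⱼ(x))² ≤ Δλ₁(x) − μ(S(x); S(Δv)(x))`** wherever `λ₂(x) < λ₁(x)`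
(the right side is K63's frame density `fd(x)`). [ours; first-order perturbation] -/
theorem gap_mul_sum_sq_partialDeriv_topProj_le (hv : Torus.IsSmooth v) {x : UnitAddTorus (Fin 3)}
    (hx : torusStrainMidEig v x < torusStrainTopEig v x) :
    (torusStrainTopEig v x - torusStrainMidEig v x) *
        ∑ k, ∑ i, ∑ j, Torus.partialDeriv k (fun y => topProj v y i j) x ^ 2 ≤
      Torus.laplacian (torusStrainTopEig v) x -
        dirTopEig (StrainL4.strainFlat v x) (StrainL4.strainFlat (Torus.laplacian v) x) := by
  obtain ⟨a₀, ha₀⟩ := exists_eigenvalues_eq_topEig v x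
  obtain ⟨he1, hSe, hgap⟩ := gapForm_eigenvectorBasis hx ha₀
  have hg : 0 < torusStrainTopEig v x - torusStrainMidEig v x := sub_pos.2 hx
  rw [dirTopEig_strainFlat_eq_of_gapForm he1 hSe hg hgap (Torus.laplacian v),
    laplacian_torusStrainTopEig_eq_sum_frame hv hx ha₀, add_sub_cancel_left, Finset.mul_sum,
    Finset.mul_sum]
  refine Finset.sum_le_sum fun k _ => ?_
  rw [sum_sq_partialDeriv_topProj_eq hv hx ha₀ k, mul_left_comm, Finset.mul_sum]
  refine mul_le_mul_of_nonneg_left (Finset.sum_le_sum fun a ha => ?_) (by norm_num)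
  have hκ := eigenvalues_le_midEig_of_ne hx ha₀ (Finset.mem_erase.1 ha).1
  set c := ((torusStrainMatrix_isHermitian v x).eigenvectorBasis a).ofLp ⬝ᵥ
    (torusStrainMatrix (Torus.partialDeriv k v) x *ᵥ
      ((torusStrainMatrix_isHermitian v x).eigenvectorBasis a₀).ofLp)
  set g := torusStrainTopEig v x - (torusStrainMatrix_isHermitian v x).eigenvalues a with hgdef
  have hle : torusStrainTopEig v x - torusStrainMidEig v x ≤ g := by rw [hgdef]; linarith
  have hgpos : 0 < g := hg.trans_le hle
  calc (torusStrainTopEig v x - torusStrainMidEig v x) * (c / g) ^ 2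
      = c ^ 2 / g * ((torusStrainTopEig v x - torusStrainMidEig v x) / g) := by rw [div_pow]; ring
    _ ≤ c ^ 2 / g * 1 :=
        mul_le_mul_of_nonneg_left ((div_le_one hgpos).2 hle) (div_nonneg (sq_nonneg _) hgpos.le)
    _ = c ^ 2 / g := mul_one _

/-- `λ₁(x) = Σᵢⱼ (∂ᵢv)ⱼ(x) (P₁)ᵢⱼ(x)` (`S u₀ = λ₁u₀`, `|u₀| = 1`, symmetry of `P₁ = u₀ ⊗ u₀`).
[ours, bookkeeping] -/
theorem topEig_eq_sum_partialDeriv_mul_topProj (x : UnitAddTorus (Fin 3)) :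
    torusStrainTopEig v x = ∑ i, ∑ j, Torus.partialDeriv i v x j * topProj v x i j := by
  have h := congrArg (fun w => topVec v x ⬝ᵥ w) (mulVec_topVec v x)
  simp only [dotProduct_smul, topVec_dotProduct_self, smul_eq_mul, mul_one] at h
  rw [← h]
  simp only [dotProduct, Matrix.mulVec, topProj, Matrix.vecMulVec_apply, torusStrainMatrix,
    Matrix.of_apply, Fin.sum_univ_three]
  ring

/-- **§ 2 TRANSPORT IDENTITY `∫ λ₁ = −∫ Σⱼ vⱼ Σᵢ ∂ᵢ(P₁)ᵢⱼ`** on an everywhere-simple smooth field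
(integration by parts entrywise). [ours] -/
theorem integral_topEig_eq_neg_integral_transport (hv : Torus.IsSmooth v)
    (hsimple : ∀ x : UnitAddTorus (Fin 3), torusStrainMidEig v x < torusStrainTopEig v x) :
    ∫ x, torusStrainTopEig v x =
      -∫ x, ∑ j, v x j * ∑ i, Torus.partialDeriv i (fun y => topProj v y i j) x := by
  have hP : ∀ i j, Torus.IsSmooth (fun y => topProj v y i j) := isSmooth_topProj_entry hv hsimple
  have hvj : ∀ j, Torus.IsSmooth (fun y => v y j) := fun j => hv.apply j
  have hpt : ∀ x, torusStrainTopEig v x =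
      ∑ i, ∑ j, Torus.partialDeriv i (fun y => v y j) x * topProj v x i j := by
    intro x
    rw [topEig_eq_sum_partialDeriv_mul_topProj]
    simp_rw [partialDeriv_coord' hv]
  have hint1 : ∀ i j,
      Integrable fun x => Torus.partialDeriv i (fun y => v y j) x * topProj v x i j :=
    fun i j => (((hvj j).partialDeriv i).continuous.mul (hP i j).continuous).integrable_unitAddTorus
  have hint2 : ∀ i j,
      Integrable fun x => v x j * Torus.partialDeriv i (fun y => topProj v y i j) x :=
    fun i j => ((hvj j).continuous.mul ((hP i j).partialDeriv i).continuous).integrable_unitAddTorus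
  have hL : ∫ x, torusStrainTopEig v x =
      ∑ i, ∑ j, ∫ x, Torus.partialDeriv i (fun y => v y j) x * topProj v x i j := by
    simp_rw [hpt]
    rw [integral_finsetSum _ fun i _ => integrable_finsetSum _ fun j _ => hint1 i j]
    exact Finset.sum_congr rfl fun i _ => integral_finsetSum _ fun j _ => hint1 i j
  have hR : ∫ x, ∑ j, v x j * ∑ i, Torus.partialDeriv i (fun y => topProj v y i j) x =
      ∑ i, ∑ j, ∫ x, v x j * Torus.partialDeriv i (fun y => topProj v y i j) x := by
    simp_rw [Finset.mul_sum]
    rw [integral_finsetSum _ fun j _ => integrable_finsetSum _ fun i _ => hint2 i j,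
      Finset.sum_comm]
    exact Finset.sum_congr rfl fun j _ => integral_finsetSum _ fun i _ => hint2 i j
  rw [hL, hR, ← Finset.sum_neg_distrib]
  refine Finset.sum_congr rfl fun i _ => ?_
  rw [← Finset.sum_neg_distrib]
  exact Finset.sum_congr rfl fun j _ => integral_partialDeriv_mul_eq_neg' (hvj j) (hP i j) i

/-- `Σⱼ (Σᵢ ∂ᵢ(P₁)ᵢⱼ)² ≤ 3 Σₖᵢⱼ (∂ₖ(P₁)ᵢⱼ)²` (Cauchy–Schwarz in `i`, diagonal terms). [folklore] -/
theorem sum_sq_div_topProj_le (x : UnitAddTorus (Fin 3)) :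
    ∑ j, (∑ i, Torus.partialDeriv i (fun y => topProj v y i j) x) ^ 2 ≤
      3 * ∑ k, ∑ i, ∑ j, Torus.partialDeriv k (fun y => topProj v y i j) x ^ 2 := by
  have hDj : ∀ j, (∑ i, Torus.partialDeriv i (fun y => topProj v y i j) x) ^ 2 ≤
      3 * ∑ i, Torus.partialDeriv i (fun y => topProj v y i j) x ^ 2 := fun j => by
    have h := sq_sum_le_card_mul_sum_sq (s := Finset.univ)
      (f := fun i => Torus.partialDeriv i (fun y => topProj v y i j) x)
    rwa [Finset.card_univ, Fintype.card_fin, Nat.cast_ofNat] at h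
  refine (Finset.sum_le_sum fun j _ => hDj j).trans ?_
  rw [← Finset.mul_sum, Finset.sum_comm]
  refine mul_le_mul_of_nonneg_left (Finset.sum_le_sum fun i _ => ?_) (by norm_num)
  rw [Finset.sum_comm]
  exact Finset.sum_le_sum fun j _ => Finset.single_le_sum
    (f := fun i' => Torus.partialDeriv i (fun y => topProj v y i' j) x ^ 2) (fun _ _ => sq_nonneg _)
    (Finset.mem_univ i)

/-- Pointwise Cauchy–Schwarz `|Σⱼ vⱼ Σᵢ ∂ᵢ(P₁)ᵢⱼ| ≤ ‖v‖ √3 |∇P₁|`. [folklore] -/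
theorem abs_transport_topProj_le (x : UnitAddTorus (Fin 3)) :
    |∑ j, v x j * ∑ i, Torus.partialDeriv i (fun y => topProj v y i j) x| ≤
      ‖v x‖ * (Real.sqrt 3 *
        Real.sqrt (∑ k, ∑ i, ∑ j, Torus.partialDeriv k (fun y => topProj v y i j) x ^ 2)) := by
  have hcs : (∑ j, v x j * ∑ i, Torus.partialDeriv i (fun y => topProj v y i j) x) ^ 2 ≤
      (∑ j, v x j ^ 2) * ∑ j, (∑ i, Torus.partialDeriv i (fun y => topProj v y i j) x) ^ 2 :=
    Finset.sum_mul_sq_le_sq_mul_sq _ _ _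
  rw [← Real.sqrt_mul (by norm_num : (0:ℝ) ≤ 3), ← Real.sqrt_sq (norm_nonneg (v x)),
    ← Real.sqrt_mul (sq_nonneg _), EuclideanSpace.real_norm_sq_eq]
  exact Real.abs_le_sqrt (hcs.trans (mul_le_mul_of_nonneg_left (sum_sq_div_topProj_le x)
    (Finset.sum_nonneg fun j _ => sq_nonneg _)))

/-- Continuity of the turning density `|∇P₁|²` on an everywhere-simple field. [ours, bookkeeping] -/
theorem continuous_sum_sq_partialDeriv_topProj (hv : Torus.IsSmooth v)
    (hsimple : ∀ x : UnitAddTorus (Fin 3), torusStrainMidEig v x < torusStrainTopEig v x) :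
    Continuous fun x => ∑ k, ∑ i, ∑ j, Torus.partialDeriv k (fun y => topProj v y i j) x ^ 2 := by
  have hP : ∀ i j, Torus.IsSmooth (fun y => topProj v y i j) := isSmooth_topProj_entry hv hsimple
  refine continuous_finsetSum _ fun k _ => continuous_finsetSum _ fun i _ =>
    continuous_finsetSum _ fun j _ => ?_
  exact ((hP i j).partialDeriv k).continuous.pow 2

/-- **§ 3 `Φ₁(v) ≤ M √3 ∫ |∇P₁|`** for everywhere-simple smooth divergence-free `v`, `‖v‖ ≤ M`. [ours] -/
theorem topEigMoment_one_le_of_simple (hv : Torus.IsSmooth v) (hdiv : Torus.IsDivFree v)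
    (hsimple : ∀ x : UnitAddTorus (Fin 3), torusStrainMidEig v x < torusStrainTopEig v x) {M : ℝ}
    (hM : ∀ x, ‖v x‖ ≤ M) :
    torusTopEigMoment 1 v ≤ M * Real.sqrt 3 *
      ∫ x, Real.sqrt (∑ k, ∑ i, ∑ j, Torus.partialDeriv k (fun y => topProj v y i j) x ^ 2) := by
  have hP : ∀ i j, Torus.IsSmooth (fun y => topProj v y i j) := isSmooth_topProj_entry hv hsimple
  have hf : Continuous fun x =>
      ∑ j, v x j * ∑ i, Torus.partialDeriv i (fun y => topProj v y i j) x :=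
    continuous_finsetSum _ fun j _ => (hv.apply j).continuous.mul
      (continuous_finsetSum _ fun i _ => ((hP i j).partialDeriv i).continuous)
  have hb : Continuous fun x => M * Real.sqrt 3 *
      Real.sqrt (∑ k, ∑ i, ∑ j, Torus.partialDeriv k (fun y => topProj v y i j) x ^ 2) :=
    ((continuous_sum_sq_partialDeriv_topProj hv hsimple).sqrt).const_mul _
  rw [FrameSpread.topEigMoment_one_eq_integral hv hdiv,
    integral_topEig_eq_neg_integral_transport hv hsimple, ← integral_const_mul]
  refine (neg_le_abs _).trans (abs_integral_le_integral_abs.trans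
    (integral_mono hf.integrable_unitAddTorus.abs hb.integrable_unitAddTorus fun x => ?_))
  have h3 : 0 ≤ Real.sqrt 3 *
      Real.sqrt (∑ k, ∑ i, ∑ j, Torus.partialDeriv k (fun y => topProj v y i j) x ^ 2) :=
    mul_nonneg (Real.sqrt_nonneg _) (Real.sqrt_nonneg _)
  calc _ ≤ _ := abs_transport_topProj_le (v := v) x
    _ ≤ M * (Real.sqrt 3 *
        Real.sqrt (∑ k, ∑ i, ∑ j, Torus.partialDeriv k (fun y => topProj v y i j) x ^ 2)) :=
        mul_le_mul_of_nonneg_right (hM x) h3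
    _ = _ := by ring

/-- The gap weight `w_q = qλ₁^{q−1}(λ₁ − λ₂)` is positive (everywhere simple, div-free, `q > 0`). [ours, bookkeeping] -/
theorem strainGapWeight_pos (hq : 0 < q) (hv : Torus.IsSmooth v) (hdiv : Torus.IsDivFree v)
    (hsimple : ∀ x : UnitAddTorus (Fin 3), torusStrainMidEig v x < torusStrainTopEig v x)
    (x : UnitAddTorus (Fin 3)) :
    0 < q * torusStrainTopEig v x ^ (q - 1) * (torusStrainTopEig v x - torusStrainMidEig v x) :=
  mul_pos (mul_pos hq (Real.rpow_pos_of_pos (topEig_pos_everywhere hv hdiv hsimple x) _))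
    (sub_pos.2 (hsimple x))

/-- Continuity of the gap weight (`q ≥ 1`; `λ₁`, `λ₂` are continuous, tree `StrainEigContinuous`). [ours, bookkeeping] -/
theorem continuous_strainGapWeight (hq : 1 ≤ q) (hv : Torus.IsSmooth v) :
    Continuous fun x =>
      q * torusStrainTopEig v x ^ (q - 1) * (torusStrainTopEig v x - torusStrainMidEig v x) :=
  (((continuous_torusStrainTopEig hv).rpow_const fun x => Or.inr (by linarith)).const_mul q).mul
    ((continuous_torusStrainTopEig hv).sub (continuous_torusStrainMidEig hv))

/-- **The inverse gap weight `w_q⁻¹` is continuous** (hence integrable: no junk value in § 5). [ours, bookkeeping] -/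
theorem continuous_inv_strainGapWeight (hq : 1 ≤ q) (hv : Torus.IsSmooth v) (hdiv : Torus.IsDivFree v)
    (hsimple : ∀ x : UnitAddTorus (Fin 3), torusStrainMidEig v x < torusStrainTopEig v x) :
    Continuous fun x =>
      (q * torusStrainTopEig v x ^ (q - 1) * (torusStrainTopEig v x - torusStrainMidEig v x))⁻¹ :=
  (continuous_strainGapWeight hq hv).inv₀ fun x => (strainGapWeight_pos (by linarith) hv hdiv hsimple x).ne'

/-- **§ 4 `∫ w_q |∇P₁|² ≤ heatDissipation Φ_q v`** (`q ≥ 1`, everywhere simple): § 1 inside the tree's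
exact channel formula for the heat term (F1 PART I Cor. 3′ (a)). [ours] -/
theorem integral_weight_mul_le_heatDissipation (hq : 1 ≤ q) (hv : Torus.IsSmooth v)
    (hdiv : Torus.IsDivFree v)
    (hsimple : ∀ x : UnitAddTorus (Fin 3), torusStrainMidEig v x < torusStrainTopEig v x) :
    ∫ x, q * torusStrainTopEig v x ^ (q - 1) * (torusStrainTopEig v x - torusStrainMidEig v x) *
        ∑ k, ∑ i, ∑ j, Torus.partialDeriv k (fun y => topProj v y i j) x ^ 2 ≤
      heatDissipation (torusTopEigMoment q) v := by
  have hgf := gapForm_of_simple hsimple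
  have hpos := topEig_pos_everywhere hv hdiv hsimple
  have hls : Torus.IsSmooth (torusStrainTopEig v) := isSmooth_torusStrainTopEig_of_simple hv hgf
  have hl := hls.continuous
  rw [heatDissipation_topEigMoment_eq_integral_of_simple hq hv hdiv hgf]
  have hA : Integrable fun x => q * (q - 1) * torusStrainTopEig v x ^ (q - 2) *
      ∑ k, Torus.partialDeriv k (torusStrainTopEig v) x ^ 2 :=
    (((hl.rpow_const fun x => Or.inl (hpos x).ne').const_mul _).mul
      (continuous_finsetSum _ fun k _ => (hls.partialDeriv k).continuous.pow 2)).integrable_unitAddTorus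
  have hB : Integrable fun x => q * torusStrainTopEig v x ^ (q - 1) *
      Torus.laplacian (torusStrainTopEig v) x :=
    (((hl.rpow_const fun x => Or.inr (by linarith)).const_mul q).mul
      hls.laplacian.continuous).integrable_unitAddTorus
  have hD := integrable_danskinDensity hq hv hv.laplacian hdiv
  refine integral_mono (((continuous_strainGapWeight hq hv).mul
    (continuous_sum_sq_partialDeriv_topProj hv hsimple)).integrable_unitAddTorus)
    ((hA.add (hB.sub hD)).congr (ae_of_all _ fun x => ?_)) fun x => ?_
  · simp only [Pi.add_apply, Pi.sub_apply]
    ring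
  · have h1 := gap_mul_sum_sq_partialDeriv_topProj_le hv (hsimple x)
    have hw : 0 ≤ q * torusStrainTopEig v x ^ (q - 1) :=
      mul_nonneg (by linarith) (Real.rpow_nonneg (hpos x).le _)
    have hAF : 0 ≤ q * (q - 1) * torusStrainTopEig v x ^ (q - 2) *
        ∑ k, Torus.partialDeriv k (torusStrainTopEig v) x ^ 2 :=
      mul_nonneg (mul_nonneg (mul_nonneg (by linarith) (by linarith)) (Real.rpow_nonneg (hpos x).le _))
        (Finset.sum_nonneg fun k _ => sq_nonneg _)
    calc _ = q * torusStrainTopEig v x ^ (q - 1) *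
          ((torusStrainTopEig v x - torusStrainMidEig v x) *
            ∑ k, ∑ i, ∑ j, Torus.partialDeriv k (fun y => topProj v y i j) x ^ 2) := by ring
      _ ≤ q * torusStrainTopEig v x ^ (q - 1) * (Torus.laplacian (torusStrainTopEig v) x -
          dirTopEig (StrainL4.strainFlat v x) (StrainL4.strainFlat (Torus.laplacian v) x)) :=
          mul_le_mul_of_nonneg_left h1 hw
      _ ≤ _ := le_add_of_nonneg_left hAF

/-- **§ 5 CAUCHY–SCHWARZ `(∫ |∇P₁|)² ≤ (∫ w_q |∇P₁|²) · ∫ w_q⁻¹`** (`q ≥ 1`, everywhere simple).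
[folklore] -/
theorem sq_integral_sqrt_le (hq : 1 ≤ q) (hv : Torus.IsSmooth v) (hdiv : Torus.IsDivFree v)
    (hsimple : ∀ x : UnitAddTorus (Fin 3), torusStrainMidEig v x < torusStrainTopEig v x) :
    (∫ x, Real.sqrt (∑ k, ∑ i, ∑ j, Torus.partialDeriv k (fun y => topProj v y i j) x ^ 2)) ^ 2 ≤
      (∫ x, q * torusStrainTopEig v x ^ (q - 1) * (torusStrainTopEig v x - torusStrainMidEig v x) *
          ∑ k, ∑ i, ∑ j, Torus.partialDeriv k (fun y => topProj v y i j) x ^ 2) *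
        ∫ x, (q * torusStrainTopEig v x ^ (q - 1) *
          (torusStrainTopEig v x - torusStrainMidEig v x))⁻¹ := by
  set w : UnitAddTorus (Fin 3) → ℝ := fun x =>
    q * torusStrainTopEig v x ^ (q - 1) * (torusStrainTopEig v x - torusStrainMidEig v x) with hw
  set G : UnitAddTorus (Fin 3) → ℝ := fun x =>
    ∑ k, ∑ i, ∑ j, Torus.partialDeriv k (fun y => topProj v y i j) x ^ 2 with hG
  have hwpos : ∀ x, 0 < w x := strainGapWeight_pos (by linarith) hv hdiv hsimple
  have hG0 : ∀ x, 0 ≤ G x := fun x => Finset.sum_nonneg fun k _ => Finset.sum_nonneg fun i _ =>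
    Finset.sum_nonneg fun j _ => sq_nonneg _
  have hf : Continuous fun x => Real.sqrt (w x * G x) :=
    ((continuous_strainGapWeight hq hv).mul (continuous_sum_sq_partialDeriv_topProj hv hsimple)).sqrt
  have hg : Continuous fun x => Real.sqrt ((w x)⁻¹) := (continuous_inv_strainGapWeight hq hv hdiv hsimple).sqrt
  have hsplit : ∀ x, Real.sqrt (G x) = Real.sqrt (w x * G x) * Real.sqrt ((w x)⁻¹) := by
    intro x
    rw [← Real.sqrt_mul (mul_nonneg (hwpos x).le (hG0 x)), mul_right_comm,
      mul_inv_cancel₀ (hwpos x).ne', one_mul]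
  have hH := integral_mul_le_Lp_mul_Lq_of_nonneg Real.HolderConjugate.two_two
    (ae_of_all _ fun x => Real.sqrt_nonneg (w x * G x))
    (ae_of_all _ fun x => Real.sqrt_nonneg ((w x)⁻¹))
    (hf.memLp_of_hasCompactSupport (μ := volume) (HasCompactSupport.of_compactSpace _))
    (hg.memLp_of_hasCompactSupport (μ := volume) (HasCompactSupport.of_compactSpace _))
  have e1 : ∫ x, Real.sqrt (w x * G x) ^ (2:ℝ) = ∫ x, w x * G x :=
    integral_congr_ae (ae_of_all _ fun x => by
      simp only [Real.rpow_two, Real.sq_sqrt (mul_nonneg (hwpos x).le (hG0 x))])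
  have e2 : ∫ x, Real.sqrt ((w x)⁻¹) ^ (2:ℝ) = ∫ x, (w x)⁻¹ :=
    integral_congr_ae (ae_of_all _ fun x => by
      simp only [Real.rpow_two, Real.sq_sqrt (inv_nonneg.2 (hwpos x).le)])
  rw [e1, e2, ← Real.sqrt_eq_rpow, ← Real.sqrt_eq_rpow] at hH
  have hA0 : 0 ≤ ∫ x, w x * G x := integral_nonneg fun x => mul_nonneg (hwpos x).le (hG0 x)
  have hB0 : 0 ≤ ∫ x, (w x)⁻¹ := integral_nonneg fun x => inv_nonneg.2 (hwpos x).le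
  show (∫ x, Real.sqrt (G x)) ^ 2 ≤ (∫ x, w x * G x) * ∫ x, (w x)⁻¹
  simp_rw [hsplit]
  calc (∫ x, Real.sqrt (w x * G x) * Real.sqrt ((w x)⁻¹)) ^ 2
      ≤ (Real.sqrt (∫ x, w x * G x) * Real.sqrt (∫ x, (w x)⁻¹)) ^ 2 :=
        pow_le_pow_left₀ (integral_nonneg fun x => mul_nonneg (Real.sqrt_nonneg _)
          (Real.sqrt_nonneg _)) hH 2
    _ = (∫ x, w x * G x) * ∫ x, (w x)⁻¹ := by rw [mul_pow, Real.sq_sqrt hA0, Real.sq_sqrt hB0]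

/-- **§ 5 ASSEMBLY `Φ₁(v)² ≤ 3M² · heatDissipation Φ_q v · ∫ w_q⁻¹`** for everywhere-simple smooth
divergence-free `v` on `T³` with `‖v‖ ≤ M`, every real `q ≥ 1`. [ours] -/
theorem topEigMoment_one_sq_le (hq : 1 ≤ q) (hv : Torus.IsSmooth v) (hdiv : Torus.IsDivFree v)
    (hsimple : ∀ x : UnitAddTorus (Fin 3), torusStrainMidEig v x < torusStrainTopEig v x) {M : ℝ}
    (hM : ∀ x, ‖v x‖ ≤ M) :
    torusTopEigMoment 1 v ^ 2 ≤ 3 * M ^ 2 * heatDissipation (torusTopEigMoment q) v *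
      ∫ x, (q * torusStrainTopEig v x ^ (q - 1) *
        (torusStrainTopEig v x - torusStrainMidEig v x))⁻¹ := by
  have h3 := topEigMoment_one_le_of_simple hv hdiv hsimple hM
  have h4 := integral_weight_mul_le_heatDissipation hq hv hdiv hsimple
  have h5 := sq_integral_sqrt_le hq hv hdiv hsimple
  have hΦ0 : 0 ≤ torusTopEigMoment 1 v := by
    rw [FrameSpread.topEigMoment_one_eq_integral hv hdiv]
    exact integral_nonneg fun x => torusStrainTopEig_nonneg (d := Fin 3) (by simp) hv hdiv x
  have hB0 : 0 ≤ ∫ x, (q * torusStrainTopEig v x ^ (q - 1) *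
      (torusStrainTopEig v x - torusStrainMidEig v x))⁻¹ :=
    integral_nonneg fun x => inv_nonneg.2 (strainGapWeight_pos (by linarith) hv hdiv hsimple x).le
  set I := ∫ x, Real.sqrt (∑ k, ∑ i, ∑ j, Torus.partialDeriv k (fun y => topProj v y i j) x ^ 2)
  set A := ∫ x, q * torusStrainTopEig v x ^ (q - 1) * (torusStrainTopEig v x - torusStrainMidEig v x) *
    ∑ k, ∑ i, ∑ j, Torus.partialDeriv k (fun y => topProj v y i j) x ^ 2
  set B := ∫ x, (q * torusStrainTopEig v x ^ (q - 1) *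
    (torusStrainTopEig v x - torusStrainMidEig v x))⁻¹
  have hM2 : 0 ≤ 3 * M ^ 2 := by positivity
  calc torusTopEigMoment 1 v ^ 2 ≤ (M * Real.sqrt 3 * I) ^ 2 := pow_le_pow_left₀ hΦ0 h3 2
    _ = 3 * M ^ 2 * I ^ 2 := by rw [mul_pow, mul_pow, Real.sq_sqrt (by norm_num : (0:ℝ) ≤ 3)]; ring
    _ ≤ 3 * M ^ 2 * (A * B) := mul_le_mul_of_nonneg_left h5 hM2
    _ ≤ 3 * M ^ 2 * (heatDissipation (torusTopEigMoment q) v * B) :=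
        mul_le_mul_of_nonneg_left (mul_le_mul_of_nonneg_right h4 hB0) hM2
    _ = _ := by ring

/-- **KILL RULE (R14).** If an everywhere-simple smooth divergence-free `v` on `T³` with `‖v‖ ≤ M` has
`heatDissipation Φ_q v ≤ c · Φ_q(v)` (`q ≥ 1`), then
`Φ₁(v)² ≤ 3M² · cΦ_q(v) · ∫ dx/(qλ₁^{q−1}(λ₁ − λ₂))`: along a killing family the inverse-gap integral
must blow up relative to `Φ₁²/(‖v‖_∞² Φ_q)`. Nothing about L-λ(q) itself is claimed. [ours] -/
theorem topEigMoment_one_sq_le_of_heat_le (hq : 1 ≤ q) (hv : Torus.IsSmooth v)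
    (hdiv : Torus.IsDivFree v)
    (hsimple : ∀ x : UnitAddTorus (Fin 3), torusStrainMidEig v x < torusStrainTopEig v x) {M c : ℝ}
    (hM : ∀ x, ‖v x‖ ≤ M) (hc : heatDissipation (torusTopEigMoment q) v ≤ c * torusTopEigMoment q v) :
    torusTopEigMoment 1 v ^ 2 ≤ 3 * M ^ 2 * (c * torusTopEigMoment q v) *
      ∫ x, (q * torusStrainTopEig v x ^ (q - 1) *
        (torusStrainTopEig v x - torusStrainMidEig v x))⁻¹ :=
  (topEigMoment_one_sq_le hq hv hdiv hsimple hM).trans (mul_le_mul_of_nonneg_right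
    (mul_le_mul_of_nonneg_left hc (by positivity)) (integral_nonneg fun x =>
      inv_nonneg.2 (strainGapWeight_pos (by linarith) hv hdiv hsimple x).le))

end TopEig.InverseGap

end Summit.NavierStokesRegularity.FunctionalMining

end
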